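import Literature.MathematicalPhysics.QuantumFieldTheory.Balaban1983to89.B9Eq3114Proof

/-!
# `Balaban1983to89.B7Prop4LinCovIterClosed` — T. Bałaban, *Averaging operations for lattice gauge theories*, Commun. Math. Phys.
# **98** (1985) 17–51 [Balaban1985Averaging] (120)–(124) pp. 35–36, (127) p. 37, p. 38; T. Bałaban, *Propagators for lattice gauge
# theories in a background field*, Commun. Math. Phys. **99** (1985) 389–434 [Balaban1985BackgroundPropagators] (3.13)–(3.15) p. 393,
# (3.115) p. 418: THE LINEAR COVARIANT AVERAGING `Q(V₀)` AND ITS COMPOSITE `Q_j(U) = Q(Ūʲ⁻¹)⋯Q(Ū)Q(U)` AS A `ℂ`-LINEAR OPERATOR AT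
# EVERY BACKGROUND — the lineage's derivative-defined `linQcov ∕ linCovIter` GATED BY THE DISC OF THE LOGARITHM (21) (print's object where
# print defines it, `0` elsewhere), its closed form (120) on the disc, (3.115) `Q_jDλ = D̄ʲQ′_jλ` and the `N(Q′)`-invariance restated for it

statement-level skeleton of published theorems with citation tags; proofs where landed; nothing here is a claim about the
Yang–Mills mass gap

PDFs held: `paper:balaban1985-cmp98-averaging` (journal page = PDF page + 16), `paper:balaban1985-cmp99-background-propagators`
(journal page = PDF page + 388); pp. 35–38 of [5] and pp. 393, 418 of [B9] read through the verbatim quotations of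
`B7Prop3GeneralLinear`, `B7Prop3GeneralTild`, `B7Prop4GeneralLevels`, `B9Eq3114Proof` and the held text layer (this seat, pp. 392–394).

CITATION HEADER (lean-in-tree rule).  Cell `pub-ymgap`, seat `pub-ymgap-dag-n06-l` (gen 35; bundle F7 rows 20–21 of the N06 certificate, K1⁹
`stmt-QuantumFields-27364` SUPPORTS lane), programme P-Q15 file 1: the averaging letter that the certificate's last displayed rows-20∕21 hypothesis
`hZ : Q ∘ D_U ∘ G′ ∘ R = 0` (print p. 426 «QG₁DR = QDG′R = D̄Q′G′R = 0») needs at NODE 00's carriers.  REUSED BY NAME, nothing restated: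
`B7Prop3GeneralLinear.FhatCov ∕ linQcov` ((112), (122)), `B7Prop3GeneralTild.QprimeCov ∕ linQcov_eq ∕ FhatCov_add ∕ FhatCov_smul ∕ QprimeCov_add ∕
QprimeCov_smul ∕ loops_flat` ((119)–(120)), `B7Prop4GeneralLevels.linCovIter ∕ linCovIter_succ` ((127), p. 38), `B7Prop2Explicit.avgIter ∕ Wcx ∕
AvgClosed`, `B7AvgGaugeCovariance.Wcx_avgIter_lt_one` (Prop. 2 at every level), `B9Eq3114Proof.eq3115 ∕ linCovIter_gauge_of_null` ((3.115)),
`B7Eq78Linearization.QprimeIter ∕ zdBlocking`, `B8Eq119TwistedAxial.bgT` ((3.19)), `B8Ineq132.covDerivFwd` ((3.3)).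

THE PRINT.  [5] p. 36, (122): *«Q(V₀, A, c) is an analytic function of A and from (120) it follows that its Taylor expansion begins with a
first-order polynomial. Let us denote it by L(Q(V₀)A)_c»*; (120): the exponent of `V̿₁(c)` is *«−i Σ_{x∈B(c₋)} L^{−d}(R_{0,c₋}A)(Γ_{c₋,x}) +
i(Q′(V₀)A)_c + i Σ_{x′∈B(c₊)} L^{−d} R̄_{0,c}(R_{0,c₊}A)(Γ_{c₊,x′}) + O(…)»*; p. 38: *«Q_{j+1}(U₀) = Q(Ū₀ʲ)Q_j(U₀)»*.  [B9] p. 393, (3.14)–(3.15):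
*«Q_j(U)A is a linear part of the function (3.13) … They are compositions of j one-step averaging operators Q_j(U) = Q(Ūʲ⁻¹)·…·Q(Ū)Q(U), (3.15)
where Q(V) is given by the explicit formula (124) in [5]»*; p. 418, (3.115): *«Q_jDλ = D^{Lʲη}_{Ūʲ}Q′_jλ = D̄ʲQ′_jλ … In particular they imply that
the average QA are invariant with respect to gauge transformations λ satisfying Q′λ = 0, i.e. λ∈N(Q′)»*.

WHY THIS FILE.  The lineage types «L(Q(V₀)A)_c» as the ray derivative `linQcov L V₀ A c := deriv (t ↦ Q(V₀, tA, c)) 0` ((122) literally) and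
proves its CLOSED FORM (120) `linQcov_eq : linQcov = −F̂_{V₀}(c₋) + (Q′(V₀)A)_c + R̄_c F̂_{V₀}(c₊)` and its additivity ∕ homogeneity ON THE DISC of the
series logarithm (`‖W_x(V₀) − 1‖ < 1` on the block `B(c₋)`, where (21) converges — print's (109) «|V₀(∂p) − 1| ≤ α₀ … α₀ ≤ c₃» puts every block
loop there).  Off that disc `linQcov` is the derivative of a non-analytic expression and need not be linear, so the composite `linCovIter L U · j`
((127)∕(3.15), un-normalised) is not a linear OPERATOR for every background — whereas NODE 00's operator layer (`Node00.OpsY*`: the averaging letter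
`Q(U) : (bond functions) →ₗ[ℂ] (index-bond functions)`) wants one `ℂ`-linear map per background `U`, regular or not.  THIS FILE takes print's object
WHERE PRINT DEFINES IT: `linQcovC L V₀ A c := linQcov L V₀ A c` if the block loops of `c` lie in the disc (`LoopDisc`), `0` otherwise — `ℂ`-linear at
EVERY background, equal to `linQcov` (and to the closed form (120)) on the disc, local and gauge-covariant with the disc (the gate `LoopDisc` is itself a
function of the block loops) — and its composite `linCovIterC` (p. 38's recursion over the level backgrounds `Ūʲ = avgIter L U j`), and records
(i) agreement with `linQcov ∕ linCovIter` on the loop discs (so every estimate ∕ identity the lineage proved for them transfers; on [5] Prop. 2's class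
every level is on the disc, `Wcx_avgIter_lt_one`), (ii) the packaged linear map `linCovIterCL`, (iii) (3.115) and print's `N(Q′)`-sentence for the gated
composite (from `B9Eq3114Proof`).  The def-Y-shaped letter on NODE 00's carriers built from `linCovIterC` is the sequel `B9Eq3115KnitLetterY`.

WHAT IS DEFINED AND PROVED (sorry-free; three definitions with bodies (`LoopDisc`, `linQcovC`, `linCovIterC`) + one packaged linear map; no `Prop` placeholder; no estimate of the papers).
* §1 `LoopDisc L V₀ c` (the block loops of `c` lie in the disc of (21)), `loopDisc_one` (flat), `linQcovC L V₀ A c` (print's «L(Q(V₀)A)_c» gated by the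
  disc), `linQcovC_eq_linQcov` (= `linQcov` on the disc), `linQcovC_of_not_loopDisc` (= 0 off it), `linQcovC_eq_closedForm` (= (120) on the disc),
  `linQcovC_add ∕ _smul ∕ _zero ∕ _neg ∕ _sub` (linear at EVERY `V₀`).
* §2 `linCovIterC L U B j` («LʲηQ_j(U)A», gated: `B` at `j = 0`, `linQcovC L (Ūʲ) (linCovIterC … j)` at the `L`-bond `⟨Lz, Lz + Le_κ⟩` at `j+1`),
  `linCovIterC_zero ∕ _succ`, `linCovIterC_add ∕ _smul ∕ _apply_zero ∕ _neg ∕ _sub`, ★ `linCovIterC_eq_linCovIter` (= `linCovIter` under the loop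
  conditions at the levels `< j`), `linCovIterC_eq_linCovIter_of_prop2` (the same on [5] Prop. 2's class, every `j ≤ k`), `linCovIterC_one_eq`
  (at `U = 1` the two composites agree unconditionally), `linCovIterCL` (the composite as a `ℂ`-linear map on bond functions) with `linCovIterCL_apply`.
* §3 ★★ `eq3115C` = (3.115) for the gated composite: `linCovIterC L U (D¹_Uλ) j (z, κ) = (D¹_{Ūʲ} Q′_jλ)(z, κ)` under the loop conditions at the
  levels `< j`; `eq3115C_of_prop2` (loop conditions DISCHARGED on Prop. 2's class); ★ `linCovIterC_covDerivFwd_eq_zero_of_null` (`(Q′_jλ)(z) =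
  (Q′_jλ)(z + e_κ) = 0 ⇒ (Q_jD¹_Uλ)(z, κ) = 0` — the bondwise form of «λ ∈ N(Q′)»), `linCovIterC_gauge_of_null` (`Q_j(A − D¹_Uλ) = Q_jA` there).

HONEST SCOPE.  Exact finite algebra over the lineage's landed objects and identities; the only hypotheses are the displayed loop conditions of
`B9Eq3114Proof` (or [5] Prop. 2's class, which implies them by `Wcx_avgIter_lt_one`); OFF the disc the letter is `0` BY DEFINITION (a declared
reading: print does not define `Q(V₀)` there); no inequality of [5]∕[B9] ((123), (126), (3.16)) is proved or
asserted; count-neutral (no new named fact); NOT summit progress; nothing continuum ∕ ℝ⁴ ∕ OS ∕ mass gap ∕ Clay — the Yang–Mills mass gap is NOT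
proved here.  NEW file; nothing landed is modified.  No `sorry`, no `axiom`, no `instance`, no `notation`.  Net new unproved facts: 0.
-/

noncomputable section

open scoped BigOperators
open NormedSpace Finset

namespace Literature.MathematicalPhysics.QuantumFieldTheory.Balaban1983to89.B7Prop4LinCovIterClosed

open B7Prop1Explicit B7Prop2Explicit B7Prop3Flat B7Eq92Concrete MatrixLog B7Prop3GeneralRotated B7Prop3GeneralLinear
  B7Prop3GeneralTild B7Prop4GeneralLevels B7AvgGaugeCovariance
open B7Eq78Linearization (conjR conjR_apply conjR_add conjR_sub conjR_smul conjR_one QprimeIter zdBlocking)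
open B8Ineq132 (covDerivFwd)
open B8Eq119TwistedAxial (bgT)

-- `Site` alone would resolve to the torus sites of `Setup.lean`; re-export the `ℤ^d` sites of `B7Prop1Explicit`.
export B7Prop1Explicit (Site)

variable {d : ℕ}
variable {𝔸 : Type*} [NormedRing 𝔸] [NormedAlgebra ℂ 𝔸] [NormOneClass 𝔸] [CompleteSpace 𝔸]
variable (L : ℕ)

/-! ## §1 The one-step linear averaging «L(Q(V₀)A)_c», gated by the disc of the logarithm (21) -/

section OneStep

/-- **THE LOOP DISC at the `L`-bond `c = ⟨q, q + Le_κ⟩`**: every block loop `W_x(V₀) = V₀(Γ_{c,x} ∪ (−c))`, `x ∈ B(c₋)`, lies in the disc of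
the series logarithm (21), `‖W_x(V₀) − 1‖ < 1` — the hypothesis shape of `B7Prop3GeneralTild.linQcov_eq` and `B9Eq3114Proof.eq3114`; print's
(109) with `α₀ ≤ c₃` puts the background there. [cite: Balaban1985Averaging, (21) p.21, (109) p.34, (42) p.23] -/
def LoopDisc (V₀ : Site d → Fin d → 𝔸ˣ) (q : Site d) (κ : Fin d) : Prop :=
  ∀ r : Fin d → Fin L, ‖((Wcx L V₀ q κ (boxVec L r) : 𝔸ˣ) : 𝔸) - 1‖ < 1

omit [NormedAlgebra ℂ 𝔸] [NormOneClass 𝔸] [CompleteSpace 𝔸] in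
/-- the trivial background is on the disc at every bond (every loop is `1`). [cite: Balaban1985Averaging, (125) p.36 (U₀ = 1)] -/
theorem loopDisc_one (q : Site d) (κ : Fin d) : LoopDisc L (1 : Site d → Fin d → 𝔸ˣ) q κ := fun r => loops_flat L q κ r

open Classical in
/-- **«L(Q(V₀)A)_c», GATED** — print's one-step linear averaging (122) (`B7Prop3GeneralLinear.linQcov`, the ray derivative of (121)) where its
block loops lie in the disc of (21), `0` elsewhere: a `ℂ`-linear function of `A` at EVERY background (`linQcovC_add ∕ _smul`), equal to `linQcov` on
the disc (`linQcovC_eq_linQcov`) and to the closed form (120) there (`linQcovC_eq_closedForm`).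
[cite: Balaban1985Averaging, (122) p.36, (120) p.35, (21) p.21; Balaban1985BackgroundPropagators, (3.14)–(3.15) p.393] -/
def linQcovC (V₀ : Site d → Fin d → 𝔸ˣ) (A : Site d → Fin d → 𝔸) (q : Site d) (κ : Fin d) : 𝔸 :=
  if LoopDisc L V₀ q κ then linQcov L V₀ A q κ else 0

omit [NormOneClass 𝔸] in
/-- ON THE DISC THE GATED LETTER IS THE LINEAR PART (122). [cite: Balaban1985Averaging, (122) p.36] -/
theorem linQcovC_eq_linQcov (V₀ : Site d → Fin d → 𝔸ˣ) (A : Site d → Fin d → 𝔸) (q : Site d) (κ : Fin d)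
    (hW : LoopDisc L V₀ q κ) : linQcovC L V₀ A q κ = linQcov L V₀ A q κ := by
  rw [linQcovC, if_pos hW]

omit [NormOneClass 𝔸] in
/-- OFF THE DISC THE GATED LETTER IS `0` (declared reading: print does not define `Q(V₀)` there). [cite: Balaban1985Averaging, (109) p.34, (21) p.21] -/
theorem linQcovC_of_not_loopDisc (V₀ : Site d → Fin d → 𝔸ˣ) (A : Site d → Fin d → 𝔸) (q : Site d) (κ : Fin d)
    (hW : ¬ LoopDisc L V₀ q κ) : linQcovC L V₀ A q κ = 0 := by
  rw [linQcovC, if_neg hW]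

/-- **ON THE DISC THE GATED LETTER IS THE CLOSED FORM (120)**: `−F̂_{V₀}(c₋) + (Q′(V₀)A)_c + R̄_c F̂_{V₀}(c₊)` (`B7Prop3GeneralTild.linQcov_eq`).
[cite: Balaban1985Averaging, (120) p.35, (122) p.36] -/
theorem linQcovC_eq_closedForm (V₀ : Site d → Fin d → 𝔸ˣ) (A : Site d → Fin d → 𝔸) (q : Site d) (κ : Fin d)
    (hW : LoopDisc L V₀ q κ) :
    linQcovC L V₀ A q κ = -FhatCov L V₀ A q + QprimeCov L V₀ A q κ + conjR (bavg L V₀ q κ) (FhatCov L V₀ A (q + (L : ℤ) • e κ)) := by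
  rw [linQcovC_eq_linQcov L V₀ A q κ hW, linQcov_eq L V₀ A q κ hW]

/-- the gated letter is ADDITIVE in `A` at every background (on the disc by `linQcov_add`, off it `0 + 0`). [cite: Balaban1985Averaging, (122) p.36 («a first-order polynomial»)] -/
theorem linQcovC_add (V₀ : Site d → Fin d → 𝔸ˣ) (A A' : Site d → Fin d → 𝔸) (q : Site d) (κ : Fin d) :
    linQcovC L V₀ (A + A') q κ = linQcovC L V₀ A q κ + linQcovC L V₀ A' q κ := by
  by_cases hW : LoopDisc L V₀ q κ
  · rw [linQcovC_eq_linQcov L V₀ _ q κ hW, linQcovC_eq_linQcov L V₀ _ q κ hW, linQcovC_eq_linQcov L V₀ _ q κ hW]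
    exact linQcov_add L V₀ A A' q κ hW
  · rw [linQcovC_of_not_loopDisc L V₀ _ q κ hW, linQcovC_of_not_loopDisc L V₀ _ q κ hW, linQcovC_of_not_loopDisc L V₀ _ q κ hW,
      add_zero]

/-- the gated letter is `ℂ`-HOMOGENEOUS in `A` at every background. [cite: Balaban1985Averaging, (122) p.36] -/
theorem linQcovC_smul (V₀ : Site d → Fin d → 𝔸ˣ) (c : ℂ) (A : Site d → Fin d → 𝔸) (q : Site d) (κ : Fin d) :
    linQcovC L V₀ (c • A) q κ = c • linQcovC L V₀ A q κ := by
  by_cases hW : LoopDisc L V₀ q κ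
  · rw [linQcovC_eq_linQcov L V₀ _ q κ hW, linQcovC_eq_linQcov L V₀ _ q κ hW]
    exact linQcov_smul L V₀ c A q κ hW
  · rw [linQcovC_of_not_loopDisc L V₀ _ q κ hW, linQcovC_of_not_loopDisc L V₀ _ q κ hW, smul_zero]

/-- the gated letter vanishes at `A = 0`. [cite: Balaban1985Averaging, (121)–(122) p.36 («Q(V₀, 0, c) = 0»)] -/
theorem linQcovC_zero (V₀ : Site d → Fin d → 𝔸ˣ) (q : Site d) (κ : Fin d) :
    linQcovC L V₀ (0 : Site d → Fin d → 𝔸) q κ = 0 := by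
  have h := linQcovC_smul L V₀ (0 : ℂ) (0 : Site d → Fin d → 𝔸) q κ
  rwa [zero_smul, zero_smul] at h

/-- the gated letter is odd in `A`. [cite: Balaban1985Averaging, (122) p.36, bookkeeping] -/
theorem linQcovC_neg (V₀ : Site d → Fin d → 𝔸ˣ) (A : Site d → Fin d → 𝔸) (q : Site d) (κ : Fin d) :
    linQcovC L V₀ (-A) q κ = -linQcovC L V₀ A q κ := by
  rw [← neg_one_smul ℂ A, linQcovC_smul, neg_one_smul]

/-- the gated letter is subtractive in `A`. [cite: Balaban1985Averaging, (122) p.36, bookkeeping] -/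
theorem linQcovC_sub (V₀ : Site d → Fin d → 𝔸ˣ) (A A' : Site d → Fin d → 𝔸) (q : Site d) (κ : Fin d) :
    linQcovC L V₀ (A - A') q κ = linQcovC L V₀ A q κ - linQcovC L V₀ A' q κ := by
  rw [sub_eq_add_neg, linQcovC_add, linQcovC_neg, ← sub_eq_add_neg]

end OneStep

/-! ## §2 The composite «LʲηQ_j(U)» = `Q(Ūʲ⁻¹)⋯Q(Ū)Q(U)`, gated levelwise — a linear operator at every background -/

section Composite

/-- **«LʲηQ_j(U)A», GATED** — p. 38's recursion «Q_{j+1}(U₀) = Q(Ū₀ʲ)Q_j(U₀)» ((3.15) of [B9]) with each factor the gated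
one-step operator `linQcovC` at the level background `Ū₀ʲ = avgIter L U₀ j`, read on the unit lattice after `j` rescalings (the level-`(j+1)` bond
`(z, κ)` is the `L`-bond `⟨Lz, Lz + Le_κ⟩` of the level-`j` lattice) — the twin of `B7Prop4GeneralLevels.linCovIter`, equal to it under the loop
conditions (`linCovIterC_eq_linCovIter`). [cite: Balaban1985Averaging, p.38 (before (133)), (127) p.37; Balaban1985BackgroundPropagators, (3.15) p.393] -/
def linCovIterC (L : ℕ) (U₀ : Site d → Fin d → 𝔸ˣ) (B : Site d → Fin d → 𝔸) : ℕ → Site d → Fin d → 𝔸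
  | 0 => B
  | j + 1 => fun z κ => linQcovC L (avgIter L U₀ j) (linCovIterC L U₀ B j) ((L : ℤ) • z) κ

variable (U₀ : Site d → Fin d → 𝔸ˣ)

omit [NormOneClass 𝔸] in
/-- `L⁰ηQ₀(U)A = ηA`. [cite: Balaban1985Averaging, (127) p.37] -/
@[simp] theorem linCovIterC_zero (B : Site d → Fin d → 𝔸) : linCovIterC L U₀ B 0 = B := rfl

omit [NormOneClass 𝔸] in
/-- «Q_{j+1}(U₀) = Q(Ū₀ʲ)Q_j(U₀)», bondwise, gated. [cite: Balaban1985Averaging, p.38 (before (133)); Balaban1985BackgroundPropagators, (3.15) p.393] -/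
theorem linCovIterC_succ (B : Site d → Fin d → 𝔸) (j : ℕ) (z : Site d) (κ : Fin d) :
    linCovIterC L U₀ B (j + 1) z κ = linQcovC L (avgIter L U₀ j) (linCovIterC L U₀ B j) ((L : ℤ) • z) κ := rfl

/-- the gated composite is ADDITIVE at every background and every level. [cite: Balaban1985Averaging, (122) p.36, p.38; Balaban1985BackgroundPropagators, (3.14) p.393 («linear part»)] -/
theorem linCovIterC_add (A B : Site d → Fin d → 𝔸) :
    ∀ j : ℕ, linCovIterC L U₀ (A + B) j = linCovIterC L U₀ A j + linCovIterC L U₀ B j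
  | 0 => rfl
  | j + 1 => by
    funext z κ
    rw [Pi.add_apply, Pi.add_apply, linCovIterC_succ, linCovIterC_succ, linCovIterC_succ, linCovIterC_add A B j, linQcovC_add]

/-- the gated composite is `ℂ`-HOMOGENEOUS at every background and every level. [cite: Balaban1985Averaging, (122) p.36, p.38; Balaban1985BackgroundPropagators, (3.14) p.393] -/
theorem linCovIterC_smul (c : ℂ) (A : Site d → Fin d → 𝔸) :
    ∀ j : ℕ, linCovIterC L U₀ (c • A) j = c • linCovIterC L U₀ A j
  | 0 => rfl
  | j + 1 => by
    funext z κ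
    rw [Pi.smul_apply, Pi.smul_apply, linCovIterC_succ, linCovIterC_succ, linCovIterC_smul c A j, linQcovC_smul]

/-- the gated composite of the zero field is zero. [cite: Balaban1985Averaging, (121)–(122) p.36] -/
theorem linCovIterC_apply_zero (j : ℕ) : linCovIterC L U₀ (0 : Site d → Fin d → 𝔸) j = 0 := by
  have h := linCovIterC_smul L U₀ (0 : ℂ) (0 : Site d → Fin d → 𝔸) j
  rwa [zero_smul, zero_smul] at h

/-- the gated composite is odd. [cite: Balaban1985Averaging, (122) p.36, bookkeeping] -/
theorem linCovIterC_neg (A : Site d → Fin d → 𝔸) (j : ℕ) : linCovIterC L U₀ (-A) j = -linCovIterC L U₀ A j := by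
  rw [← neg_one_smul ℂ A, linCovIterC_smul, neg_one_smul]

/-- the gated composite is subtractive. [cite: Balaban1985Averaging, (122) p.36, bookkeeping] -/
theorem linCovIterC_sub (A B : Site d → Fin d → 𝔸) (j : ℕ) :
    linCovIterC L U₀ (A - B) j = linCovIterC L U₀ A j - linCovIterC L U₀ B j := by
  rw [sub_eq_add_neg, linCovIterC_add, linCovIterC_neg, ← sub_eq_add_neg]

omit [NormOneClass 𝔸] in
/-- ★ **ON THE LOOP DISCS THE GATED COMPOSITE IS THE LINEAGE's `linCovIter`**: if the block loops of every level background `Ū₀ⁱ`, `i < j`,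
lie in the disc of the logarithm (the hypothesis shape of `B9Eq3114Proof.eq3115`), then `linCovIterC L U₀ B j = linCovIter L U₀ B j`.
[cite: Balaban1985Averaging, (120)–(122) pp.35–36, (127) p.37; Balaban1985BackgroundPropagators, (3.15) p.393] -/
theorem linCovIterC_eq_linCovIter (B : Site d → Fin d → 𝔸) :
    ∀ j : ℕ, (∀ i < j, ∀ (z : Site d) (κ : Fin d) (r : Fin d → Fin L),
        ‖((Wcx L (avgIter L U₀ i) ((L : ℤ) • z) κ (boxVec L r) : 𝔸ˣ) : 𝔸) - 1‖ < 1) →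
      linCovIterC L U₀ B j = linCovIter L U₀ B j
  | 0, _ => rfl
  | j + 1, hW => by
    funext z κ
    rw [linCovIterC_succ, linCovIter_succ, linCovIterC_eq_linCovIter B j fun i hi => hW i (Nat.lt_succ_of_lt hi)]
    exact linQcovC_eq_linQcov L _ _ _ κ (hW j (Nat.lt_succ_self j) z κ)

/-- **THE SAME ON [5] PROPOSITION 2's CLASS**: for `U₀` with values in an averaging-closed `G ⊂ {|u| ≤ 1, |u⁻¹| ≤ 1}`, `pdev U₀ < α₀L^{−2k}` ((52))
and the printed smallness of `α₀`, every block loop of every `Ū₀ⁱ`, `i ≤ k`, lies in the disc (`B7AvgGaugeCovariance.Wcx_avgIter_lt_one`), hence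
`linCovIterC L U₀ B j = linCovIter L U₀ B j` for all `j ≤ k`. [cite: Balaban1985Averaging, Prop. 2 (52)–(54) p.26, p.37 (after (127))] -/
theorem linCovIterC_eq_linCovIter_of_prop2 (hL : 2 ≤ L) {G : Subgroup 𝔸ˣ} (hG : AvgClosed d L G) (k : ℕ)
    (hU₀ : ∀ x κ, U₀ x κ ∈ G) {α₀ : ℝ} (hα : 0 < α₀) (hα3 : C0 d * α₀ ≤ 1 / 3) (hα2 : 2 * α₀ ≤ c2' d L)
    (h52 : pdev U₀ < α₀ * (((L : ℝ) ^ k)⁻¹) ^ 2) (B : Site d → Fin d → 𝔸) :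
    ∀ j ≤ k, linCovIterC L U₀ B j = linCovIter L U₀ B j :=
  fun j hj => linCovIterC_eq_linCovIter L U₀ B j fun i hi z κ r =>
    Wcx_avgIter_lt_one L hL hG k U₀ hU₀ hα hα3 hα2 h52 i (le_trans hi.le hj) ((L : ℤ) • z) κ r

omit [NormOneClass 𝔸] in
/-- at the TRIVIAL background the two composites agree at every level, unconditionally (every loop of `1̄ⁱ = 1` is `1`, `loops_flat`).
[cite: Balaban1985Averaging, (125) p.36, (127) p.37; Balaban1985BackgroundPropagators, Cor. 3.5 p.407 (U = 1)] -/
theorem linCovIterC_one_eq (B : Site d → Fin d → 𝔸) (j : ℕ) :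
    linCovIterC L (1 : Site d → Fin d → 𝔸ˣ) B j = linCovIter L (1 : Site d → Fin d → 𝔸ˣ) B j :=
  linCovIterC_eq_linCovIter L 1 B j fun i _ z κ r => by
    rw [avgIter_one]
    exact loops_flat L _ κ r

/-- **THE GATED COMPOSITE AS A `ℂ`-LINEAR OPERATOR on bond functions**, one per background and level — the shape NODE 00's operator layer wants
for print's `Q_j(U)` ((3.14): «Q_j(U)A is a linear part …»). [cite: Balaban1985BackgroundPropagators, (3.14)–(3.15) p.393; Balaban1985Averaging, (122) p.36] -/
def linCovIterCL (L : ℕ) (U₀ : Site d → Fin d → 𝔸ˣ) (j : ℕ) : (Site d → Fin d → 𝔸) →ₗ[ℂ] (Site d → Fin d → 𝔸) where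
  toFun B := linCovIterC L U₀ B j
  map_add' A B := linCovIterC_add L U₀ A B j
  map_smul' c A := linCovIterC_smul L U₀ c A j

/-- `linCovIterCL` is `linCovIterC`. [cite: Balaban1985BackgroundPropagators, (3.14) p.393, bookkeeping] -/
@[simp] theorem linCovIterCL_apply (j : ℕ) (B : Site d → Fin d → 𝔸) : linCovIterCL L U₀ j B = linCovIterC L U₀ B j := rfl

end Composite

/-! ## §3 (3.115) `Q_jDλ = D̄ʲQ′_jλ` and «λ ∈ N(Q′)» for the gated composite -/

section Eq3115

variable (U : Site d → Fin d → 𝔸ˣ)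

/-- ★★ **(3.115) FOR THE GATED COMPOSITE** — p. 418: *«Q_jDλ = D^{Lʲη}_{Ūʲ}Q′_jλ = D̄ʲQ′_jλ»*: with `D = D¹_U` the forward covariant derivative
(3.3) (`covDerivFwd 1 U`), `Q′_j = Q′(Ūʲ⁻¹)⋯Q′(U)` the composite block average (3.19) (`QprimeIter (zdBlocking d L) (bgT L U) j`), `Ūʲ = avgIter L U j`
and `D̄ʲ = D¹_{Ūʲ}` on the level-`j` lattice: `linCovIterC L U (Dλ) j (z, κ) = (D̄ʲQ′_jλ)(z, κ)` for every `j`, `λ`, coarse bond, under the loop conditions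
at the levels `< j` (`B9Eq3114Proof.eq3115` + `linCovIterC_eq_linCovIter`). [cite: Balaban1985BackgroundPropagators, (3.115) p.418] -/
theorem eq3115C (hL : 1 ≤ L) (lam : Site d → 𝔸) (j : ℕ)
    (hW : ∀ i < j, ∀ (z : Site d) (κ : Fin d) (r : Fin d → Fin L),
      ‖((Wcx L (avgIter L U i) ((L : ℤ) • z) κ (boxVec L r) : 𝔸ˣ) : 𝔸) - 1‖ < 1)
    (z : Site d) (κ : Fin d) :
    linCovIterC L U (fun x μ => covDerivFwd 1 U μ lam x) j z κ
      = covDerivFwd 1 (avgIter L U j) κ (QprimeIter (zdBlocking d L) (bgT L U) j lam) z := by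
  rw [linCovIterC_eq_linCovIter L U _ j hW]
  exact B9Eq3114Proof.eq3115 L hL U lam j hW z κ

/-- **(3.115) ON [5] PROPOSITION 2's CLASS**, loop conditions DISCHARGED: `G` averaging-closed, `U` `G`-valued, `pdev U < α₀L^{−2k}`, `C₀α₀ ≤ 1/3`,
`2α₀ ≤ c₂′`, `L ≥ 2` ⇒ `linCovIterC L U (Dλ) j = D̄ʲQ′_jλ` for every `j ≤ k`. [cite: Balaban1985BackgroundPropagators, (3.115) p.418; Balaban1985Averaging, Prop. 2 p.26] -/
theorem eq3115C_of_prop2 (hL : 2 ≤ L) {G : Subgroup 𝔸ˣ} (hG : AvgClosed d L G) (k : ℕ)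
    (hU : ∀ x κ, U x κ ∈ G) {α₀ : ℝ} (hα : 0 < α₀) (hα3 : C0 d * α₀ ≤ 1 / 3) (hα2 : 2 * α₀ ≤ c2' d L)
    (h52 : pdev U < α₀ * (((L : ℝ) ^ k)⁻¹) ^ 2) (lam : Site d → 𝔸) :
    ∀ j ≤ k, ∀ (z : Site d) (κ : Fin d),
      linCovIterC L U (fun x μ => covDerivFwd 1 U μ lam x) j z κ
        = covDerivFwd 1 (avgIter L U j) κ (QprimeIter (zdBlocking d L) (bgT L U) j lam) z :=
  fun j hj z κ => eq3115C L U (le_trans (by norm_num) hL) lam j (fun i hi z κ r =>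
    Wcx_avgIter_lt_one L hL hG k U hU hα hα3 hα2 h52 i (le_trans hi.le hj) ((L : ℤ) • z) κ r) z κ

omit [NormOneClass 𝔸] [CompleteSpace 𝔸] in
/-- [folklore] unfolding of the forward covariant derivative at `η = 1`: `(D¹_Vλ)(x, μ) = R(V(x, μ))λ(x + e_μ) − λ(x)`. -/
private theorem covDerivFwd_one_apply (V : Site d → Fin d → 𝔸ˣ) (μ : Fin d) (lam : Site d → 𝔸) (x : Site d) :
    covDerivFwd 1 V μ lam x = conjR (V x μ) (lam (x + e μ)) - lam x := by
  simp [covDerivFwd]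

/-- ★ **«λ ∈ N(Q′)», BONDWISE, FOR THE GATED COMPOSITE**: if `(Q′_jλ)` vanishes at both ends of the coarse bond `(z, κ)`, then
`linCovIterC L U (D¹_Uλ) j (z, κ) = 0` — by (3.115) the value is `R(Ūʲ(z, κ))(Q′_jλ)(z + e_κ) − (Q′_jλ)(z)`. (Loop conditions at the levels `< j`.)
[cite: Balaban1985BackgroundPropagators, p.418 (after (3.115)), (3.124) p.420] -/
theorem linCovIterC_covDerivFwd_eq_zero_of_null (hL : 1 ≤ L) (lam : Site d → 𝔸) (j : ℕ)
    (hW : ∀ i < j, ∀ (z : Site d) (κ : Fin d) (r : Fin d → Fin L),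
      ‖((Wcx L (avgIter L U i) ((L : ℤ) • z) κ (boxVec L r) : 𝔸ˣ) : 𝔸) - 1‖ < 1)
    (z : Site d) (κ : Fin d) (h0 : QprimeIter (zdBlocking d L) (bgT L U) j lam z = 0)
    (h1 : QprimeIter (zdBlocking d L) (bgT L U) j lam (z + e κ) = 0) :
    linCovIterC L U (fun x μ => covDerivFwd 1 U μ lam x) j z κ = 0 := by
  rw [eq3115C L U hL lam j hW z κ, covDerivFwd_one_apply, h0, h1, sub_zero]
  simp [conjR_apply]

/-- **«the average QA are invariant with respect to gauge transformations λ satisfying Q′λ = 0»**, bondwise, for the gated composite: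
`linCovIterC L U (A − D¹_Uλ) j (z, κ) = linCovIterC L U A j (z, κ)` when `(Q′_jλ)` vanishes at both ends of `(z, κ)` (subtractivity is
unconditional here; (3.115) needs the loop conditions at the levels `< j`). [cite: Balaban1985BackgroundPropagators, p.418 (after (3.115))] -/
theorem linCovIterC_gauge_of_null (hL : 1 ≤ L) (A : Site d → Fin d → 𝔸) (lam : Site d → 𝔸) (j : ℕ)
    (hW : ∀ i < j, ∀ (z : Site d) (κ : Fin d) (r : Fin d → Fin L),
      ‖((Wcx L (avgIter L U i) ((L : ℤ) • z) κ (boxVec L r) : 𝔸ˣ) : 𝔸) - 1‖ < 1)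
    (z : Site d) (κ : Fin d) (h0 : QprimeIter (zdBlocking d L) (bgT L U) j lam z = 0)
    (h1 : QprimeIter (zdBlocking d L) (bgT L U) j lam (z + e κ) = 0) :
    linCovIterC L U (fun x μ => A x μ - covDerivFwd 1 U μ lam x) j z κ = linCovIterC L U A j z κ := by
  have hsub : (fun x μ => A x μ - covDerivFwd 1 U μ lam x) = A - fun x μ => covDerivFwd 1 U μ lam x := rfl
  rw [hsub, linCovIterC_sub, Pi.sub_apply, Pi.sub_apply, linCovIterC_covDerivFwd_eq_zero_of_null L U hL lam j hW z κ h0 h1,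
    sub_zero]

end Eq3115

end Literature.MathematicalPhysics.QuantumFieldTheory.Balaban1983to89.B7Prop4LinCovIterClosed

end
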